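import Summits.ResolutionOfSingularities.ResolutionOfSingularities.Theorems.UniformComplexityPrimeModelTransferAlgClosedTower
import HarnessLib

/-!
# Crux `PrimeModelTransfer` (stmt-ResolutionOfSingularities-8933): the tower through the algebraic
# closures of FINITELY GENERATED subfields — door 2 needs the kernel only at `(𝔽_p(s))^{alg} ∩ K`

Route `ResolutionOfSingularities/UniformComplexity`, crux `PrimeModelTransfer`. Companion to
`Theorems/UniformComplexityPrimeModelTransferAlgClosedTower.lean` (p470438), whose tower
`exists_isAlgClosed_subfield_hasResolution` produces, for every finite `S ⊆ K` (`K` algebraically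
closed of characteristic `p`), SOME algebraically closed subfield `A ⊇ S` with resolution, using the
transfer kernel at arbitrary algebraically closed constant fields `M`.

**This file (Theses-free) pins the tower down**: `A(S)` IS the relative algebraic closure
`(closure S)^{alg} ∩ K` of the subfield generated by `S` — an algebraically closed field of finite
transcendence degree over `𝔽_p` — and the kernel is consumed ONLY at constant fields of exactly this
shape (`M = ↥(algebraicClosure (Subfield.closure ↑s) K)`, `s` finite). Contents:

* `isAlgebraic_of_forall_mem` — transport of `IsAlgebraic` from a subfield-like `S₁ ⊆ K` to a
  larger `S₂ ⊇ S₁` (Mathlib's `IsAlgebraic.ringHom_of_comp_eq` along the inclusion);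
* `mem_algebraicClosure_closure_insert_iff` — the SUBFIELD IDENTITY driving the induction: for an
  intermediate step `A = (closure S)^{alg} ∩ K` and `t ∈ K`, an element of `K` is algebraic over
  `closure (S ∪ {t})` iff it is algebraic over `A(t)`; i.e.
  `(closure (S ∪ {t}))^{alg} ∩ K = (A(t))^{alg} ∩ K` as subsets of `K`;
* `hasResolution_algebraicClosure_closure` — THE PINNED TOWER: for `K` algebraically closed of
  characteristic `p`, the crux hypothesis (resolution over algebraically closed fields algebraic
  over `𝔽_p`) and the kernel AT THE FIELDS `(closure s)^{alg} ∩ K` (`s ⊆ K` finite) give resolution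
  of all integral separated finite-type schemes over `(closure S)^{alg} ∩ K` for every finite `S`
  (induction on `S`; the step is `hasResolution_algebraicClosure_adjoin_simple` of p470438 at
  `M = A(S)` followed by transport along the subfield identity, `hasResolution_of_integralResOver_ringEquiv`).

The leaf `Theorems/UniformComplexityPrimeModelTransferOfClimbAlgClosureFg.lean` turns this into
`PrimeModelTransfer` BY NAME: door 2 of slot W8.2 needs the shared kernel only for the countably many
(up to isomorphism) constant fields `(𝔽_p(t₁,…,t_n))^{alg}`.

[OURS · LADDER-RESOLUTION L1, slot W8.2 (prime-field / universality transfer), door 2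
UniformComplexity] Helper lemmas over the summit's own route; NOT statements of, and attributing
nothing to, Hironaka's 2017 manuscript. No lemma base-changes a resolution along an inseparable
extension (barrier bookkeeping as in p470438).

Sources: Stacks Project 09GI (relative algebraic closure), 030A (towers of algebraic extensions);
Q. Liu, *Algebraic Geometry and Arithmetic Curves* (2002), Cor. 4.3.33. [cite: Liu2002, Cor. 4.3.33]
-/

noncomputable section

set_option linter.dupNamespace false -- mandated namespace of this single-conjunct summit

open CategoryTheory CategoryTheory.Limits AlgebraicGeometry TopologicalSpace
open Literature.AlgebraicGeometry.Resolution

namespace Summit.ResolutionOfSingularities.ResolutionOfSingularities.Theorems.PrimeModelTransfer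

/-! ## §1 Algebraicity along inclusions of subfields -/

/-- **`IsAlgebraic` is monotone in the base subfield.** For subfield-like subobjects `S₁, S₂` of a
field `K` with `S₁ ⊆ S₂` (as subsets of `K`), an element of `K` algebraic over `S₁` is algebraic
over `S₂` (Mathlib's `IsAlgebraic.ringHom_of_comp_eq` along the inclusion `S₁ → S₂` and the
identity of `K`). [folklore] -/
theorem isAlgebraic_of_forall_mem {K : Type} [Field K] {σ₁ σ₂ : Type} [SetLike σ₁ K] [SetLike σ₂ K]
    [SubfieldClass σ₁ K] [SubfieldClass σ₂ K] (S₁ : σ₁) (S₂ : σ₂)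
    [Algebra S₁ K] [Algebra S₂ K]
    (h₁ : ∀ y : S₁, algebraMap S₁ K y = y) (h₂ : ∀ y : S₂, algebraMap S₂ K y = y)
    (hle : ∀ y : K, y ∈ S₁ → y ∈ S₂) {x : K} (hx : IsAlgebraic S₁ x) : IsAlgebraic S₂ x := by
  let ι : S₁ →+* S₂ := (algebraMap S₁ K).codRestrict S₂ fun y => by rw [h₁]; exact hle y y.2
  have hι : Function.Injective ι := fun a b hab => by
    apply Subtype.ext
    have := congrArg (fun z : S₂ => (z : K)) hab
    simpa [ι, h₁] using this
  have hcomp : (algebraMap S₂ K).comp ι = (RingHom.id K).comp (algebraMap S₁ K) := by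
    ext y
    simp [ι, h₁, h₂]
  simpa using hx.ringHom_of_comp_eq ι (RingHom.id K) hι hcomp

/-! ## §2 The subfield identity `(closure (S ∪ {t}))^{alg} ∩ K = (A(S)(t))^{alg} ∩ K` -/

/-- **The subfield identity.** Let `K` be a field, `S ⊆ K` finite, `A := (closure S)^{alg} ∩ K`
the relative algebraic closure of the subfield generated by `S`, and `t ∈ K`. Then an element of `K`
is algebraic over `A(t)` iff it is algebraic over `closure (S ∪ {t})`. (⇐: `closure (S ∪ {t}) ⊆ A(t)`.
⇒: `A(t) ⊆ (closure (S ∪ {t}))^{alg} ∩ K`, and the relative algebraic closure is algebraically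
closed in `K`, `algebraicClosure.algebraicClosure_eq_bot`.) [folklore] -/
theorem mem_algebraicClosure_closure_insert_iff {K : Type} [Field K] [DecidableEq K]
    (S : Finset K) (t : K) (x : K) :
    x ∈ algebraicClosure
        (IntermediateField.adjoin (algebraicClosure (Subfield.closure (↑S : Set K)) K)
          ({t} : Set K)) K ↔
      x ∈ algebraicClosure (Subfield.closure (↑(insert t S) : Set K)) K := by
  -- notation
  let F : Subfield K := Subfield.closure (↑S : Set K)
  let A : IntermediateField F K := algebraicClosure F K
  let E : IntermediateField A K := IntermediateField.adjoin A ({t} : Set K)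
  let F' : Subfield K := Subfield.closure (↑(insert t S) : Set K)
  let A' : IntermediateField F' K := algebraicClosure F' K
  change x ∈ algebraicClosure E K ↔ x ∈ A'
  -- `F ≤ F'`, hence `A ⊆ A'`
  have hFF' : F ≤ F' := Subfield.closure_mono (by simp [Finset.coe_insert])
  have hAA' : ∀ y : K, y ∈ A → y ∈ A' := fun y hy =>
    mem_algebraicClosure_iff.2
      (isAlgebraic_of_forall_mem F F' (fun _ => rfl) (fun _ => rfl) (fun z hz => hFF' hz)
        (mem_algebraicClosure_iff.1 hy))
  -- `t ∈ A'` and `E ⊆ A'`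
  have htA' : t ∈ A' :=
    A'.algebraMap_mem (⟨t, Subfield.subset_closure (by simp [Finset.coe_insert])⟩ : F')
  have hEA' : ∀ y : K, y ∈ E → y ∈ A' := by
    let T : IntermediateField A K :=
      A'.toSubfield.toIntermediateField fun a => by
        rw [IntermediateField.mem_toSubfield]
        exact hAA' a a.2
    have hET : E ≤ T := IntermediateField.adjoin_le_iff.mpr (by
      intro y hy
      rw [Set.mem_singleton_iff] at hy
      rw [hy]
      change t ∈ A'.toSubfield
      rw [IntermediateField.mem_toSubfield]
      exact htA')
    intro y hy
    have : y ∈ T := hET hy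
    change y ∈ A'.toSubfield at this
    rwa [IntermediateField.mem_toSubfield] at this
  -- `F' ≤ E` (as subsets of `K`): `t ∈ E` and `S ⊆ F ⊆ A ⊆ E`
  have hF'E : ∀ y : K, y ∈ F' → y ∈ E := by
    intro y hy
    have hle : F' ≤ E.toSubfield := by
      refine Subfield.closure_le.2 ?_
      intro z hz
      rw [Finset.coe_insert, Set.mem_insert_iff] at hz
      change z ∈ E.toSubfield
      rw [IntermediateField.mem_toSubfield]
      rcases hz with rfl | hz
      · exact IntermediateField.mem_adjoin_simple_self A z
      · have hzF : z ∈ F := Subfield.subset_closure hz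
        have hzA : z ∈ A := A.algebraMap_mem (⟨z, hzF⟩ : F)
        exact E.algebraMap_mem (⟨z, hzA⟩ : A)
    have := hle hy
    change y ∈ E.toSubfield at this
    rwa [IntermediateField.mem_toSubfield] at this
  constructor
  · -- `x` algebraic over `E ⊆ A'` ⇒ algebraic over `A'` ⇒ `x ∈ (A')^{alg} ∩ K = A'`
    intro hx
    have hx' : IsAlgebraic A' x :=
      isAlgebraic_of_forall_mem E A' (fun _ => rfl) (fun _ => rfl) hEA' (mem_algebraicClosure_iff.1 hx)
    have hbot : x ∈ (⊥ : IntermediateField A' K) := by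
      rw [← algebraicClosure.algebraicClosure_eq_bot F' K]
      exact mem_algebraicClosure_iff.2 hx'
    rw [IntermediateField.mem_bot] at hbot
    obtain ⟨a, rfl⟩ := hbot
    exact a.2
  · -- `x` algebraic over `F' ⊆ E` ⇒ algebraic over `E`
    intro hx
    exact mem_algebraicClosure_iff.2
      (isAlgebraic_of_forall_mem F' E (fun _ => rfl) (fun _ => rfl) hF'E (mem_algebraicClosure_iff.1 hx))

/-! ## §3 The pinned tower `A(S) = (closure S)^{alg} ∩ K` -/

/-- **The pinned tower.** Let `K` be an algebraically closed field of characteristic `p`. Assume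
(i) the hypothesis of the crux `PrimeModelTransfer` at `p` — every integral separated scheme of
finite type over an algebraically closed field of characteristic `p` algebraic over `𝔽_p` has a
resolution — and (ii) the transfer kernel at the constant fields `(closure s)^{alg} ∩ K`, `s ⊆ K`
finite (algebraically closed, of finite transcendence degree over `𝔽_p`): resolution of all integral
separated finite-type schemes over such a field gives the same over every perfect field purely
inseparable over its rational function field. Then, for every finite `S ⊆ K`, every integral
separated scheme of finite type over `(closure S)^{alg} ∩ K` has a resolution. Induction on `S`:
`S = ∅` is (i) (the field is algebraic over the prime field: `pow_prime_pow_eq_self_of_isAlgebraic`);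
the step is the climb `hasResolution_algebraicClosure_adjoin_simple` (p470438) at `M = A(S)`,
landing in `(A(S)(t))^{alg} ∩ K`, transported to `A(S ∪ {t})` along the subfield identity
`mem_algebraicClosure_closure_insert_iff` (`hasResolution_of_integralResOver_ringEquiv`). [folklore] -/
theorem hasResolution_algebraicClosure_closure (p : ℕ) [Fact p.Prime]
    (K : Type) [Field K] [CharP K p] [IsAlgClosed K]
    (hA : ∀ (k : Type) [Field k] [CharP k p] [IsAlgClosed k],
      (∀ x : k, ∃ n : ℕ, 0 < n ∧ x ^ p ^ n = x) →
      ∀ (X : Scheme.{0}) (f : X ⟶ Spec (.of k)), IsSeparated f → LocallyOfFiniteType f →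
        QuasiCompact f → IsIntegral X → Scheme.HasResolution X)
    (hker : ∀ (s : Finset K),
      (∀ (X : Scheme.{0})
        (f : X ⟶ Spec (.of (algebraicClosure (Subfield.closure (↑s : Set K)) K))),
        IsSeparated f → LocallyOfFiniteType f → QuasiCompact f → IsIntegral X →
          Scheme.HasResolution X) →
      ∀ (L : Type) [Field L] [PerfectField L]
        [Algebra (RatFunc (algebraicClosure (Subfield.closure (↑s : Set K)) K)) L]
        [IsPurelyInseparable (RatFunc (algebraicClosure (Subfield.closure (↑s : Set K)) K)) L]
        (X : Scheme.{0}) (f : X ⟶ Spec (.of L)), IsSeparated f → LocallyOfFiniteType f →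
          QuasiCompact f → IsIntegral X → Scheme.HasResolution X)
    (S : Finset K) (X : Scheme.{0})
    (f : X ⟶ Spec (.of (algebraicClosure (Subfield.closure (↑S : Set K)) K)))
    (hs : IsSeparated f) (hl : LocallyOfFiniteType f) (hq : QuasiCompact f) (hX : IsIntegral X) :
    Scheme.HasResolution X := by
  classical
  induction S using Finset.induction_on generalizing X with
  | empty =>
    -- `A(∅) = (closure ∅)^{alg} ∩ K` is algebraically closed and algebraic over the prime field
    let F₀ : Subfield K := Subfield.closure (↑(∅ : Finset K) : Set K)
    let A₀ : IntermediateField F₀ K := algebraicClosure F₀ K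
    haveI : IsAlgClosed A₀ := IsAlgClosure.isAlgClosed F₀
    haveI : CharP A₀ p := (algebraMap A₀ K).charP (algebraMap A₀ K).injective p
    letI : Algebra (ZMod p) K := ZMod.algebra K p
    -- `F₀ = closure ∅ ⊆ P := (ZMod p)^{alg} ∩ K` (the prime field lies in every subfield), so an
    -- element algebraic over `F₀` is algebraic over `P`, hence lies in `P^{alg} ∩ K = P`, i.e. is
    -- algebraic over `ZMod p`
    let P : IntermediateField (ZMod p) K := algebraicClosure (ZMod p) K
    have hF₀P : ∀ y : K, y ∈ F₀ → y ∈ P := fun y hy => by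
      have hle : F₀ ≤ P.toSubfield := Subfield.closure_le.2 (by simp)
      have := hle hy
      rwa [IntermediateField.mem_toSubfield] at this
    have halg : ∀ x : A₀, ∃ n : ℕ, 0 < n ∧ x ^ p ^ n = x := fun x => by
      have hxF : IsAlgebraic F₀ (x : K) := mem_algebraicClosure_iff.1 x.2
      have hxP : IsAlgebraic P (x : K) :=
        isAlgebraic_of_forall_mem F₀ P (fun _ => rfl) (fun _ => rfl) hF₀P hxF
      have hbot : (x : K) ∈ (⊥ : IntermediateField P K) := by
        rw [← algebraicClosure.algebraicClosure_eq_bot (ZMod p) K]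
        exact mem_algebraicClosure_iff.2 hxP
      rw [IntermediateField.mem_bot] at hbot
      obtain ⟨a, ha⟩ := hbot
      have hxZ : IsAlgebraic (ZMod p) (x : K) := by
        rw [← ha]
        exact mem_algebraicClosure_iff.1 a.2
      obtain ⟨n, hn, hx⟩ := pow_prime_pow_eq_self_of_isAlgebraic p (x : K) hxZ
      exact ⟨n, hn, Subtype.ext (by simpa using hx)⟩
    exact hA A₀ halg X f hs hl hq hX
  | insert t S htS ih =>
    -- the constant field of this climb: `M := A(S)`, algebraically closed, with resolution (`ih`)
    let F : Subfield K := Subfield.closure (↑S : Set K)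
    let A : IntermediateField F K := algebraicClosure F K
    haveI : IsAlgClosed A := IsAlgClosure.isAlgClosed F
    haveI : PerfectField A := IsAlgClosed.perfectField A
    haveI : CharP A p := (algebraMap A K).charP (algebraMap A K).injective p
    have hM : ∀ (Y : Scheme.{0}) (g : Y ⟶ Spec (.of A)), IsSeparated g → LocallyOfFiniteType g →
        QuasiCompact g → IsIntegral Y → Scheme.HasResolution Y :=
      fun Y g hs' hl' hq' hY => ih Y g hs' hl' hq' hY
    -- one climb: resolution over `L := (A(t))^{alg} ∩ K` (kernel used at `M = A(S)` only)
    let E : IntermediateField A K := IntermediateField.adjoin A ({t} : Set K)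
    let L : IntermediateField E K := algebraicClosure E K
    have hL : ∀ (Y : Scheme.{0}) (g : Y ⟶ Spec (.of L)), IsSeparated g → LocallyOfFiniteType g →
        QuasiCompact g → IsIntegral Y → Scheme.HasResolution Y :=
      fun Y g hs' hl' hq' hY =>
        hasResolution_algebraicClosure_adjoin_simple p A hM (fun L' _ _ _ _ => hker S hM L') K t
          Y g hs' hl' hq' hY
    -- transport along the subfield identity `L = A(S ∪ {t})`
    let F' : Subfield K := Subfield.closure (↑(insert t S) : Set K)
    let A' : IntermediateField F' K := algebraicClosure F' K
    have hiff : ∀ y : K, y ∈ L ↔ y ∈ A' := fun y => mem_algebraicClosure_closure_insert_iff S t y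
    let ι : L →+* A' := (algebraMap L K).codRestrict A' fun y => (hiff y).1 y.2
    have hι : Function.Bijective ι := by
      constructor
      · intro a b hab
        apply Subtype.ext
        have := congrArg (fun z : A' => (z : K)) hab
        simpa [ι] using this
      · intro z
        refine ⟨⟨z, (hiff z).2 z.2⟩, Subtype.ext ?_⟩
        simp [ι]
    let e : L ≃+* A' := RingEquiv.ofBijective ι hι
    exact hasResolution_of_integralResOver_ringEquiv e hL X f hs hl hq hX

end Summit.ResolutionOfSingularities.ResolutionOfSingularities.Theorems.PrimeModelTransfer

end
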